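import Summits.AnomalousDissipation.AnomalousDissipation.Theorems.SolenoidalFractalHomogenisationRealisedQuasiStaticCellLawComovingPairTransport
import Summits.AnomalousDissipation.AnomalousDissipation.Theorems.SolenoidalFractalHomogenisationRealisedQuasiStaticCellLawComovingFrameBridge
import HarnessLib

/-!
# K2R `RealisedQuasiStaticCellLaw`, line `floquet-bloch`, stub `stub_lowSectorWeakNear`: the junction inequality of
# `isoSector_decay_ae` from the co-moving junction (helper; `--supports stmt-AnomalousDissipation-20446`)

Summits-side helper file (everything proved; no definitions, no named facts). `comoving_junc` (p584793) states the slot-junction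
inequality of the co-moving weights in the coordinates `(x₁, x₂)` of the REFERENCE frame `(ζ₀, k̂ × ζ₀)` (`ζ₀ = ζ_{slot 0}`,
`k̂ = ℓ/‖ℓ‖`), each slot frame being the rotation `(rc_j, rs_j) = (ζ₀·ζ_j, (k̂×ζ₀)·ζ_j)` of it; `isoSector_decay_ae` (p582517)
wants it (`hjunc`) in terms of the inner products `⟨ζ_j, u⟩`, `⟨p_j(0), u⟩` of an arbitrary transversal vector `u ∈ ℂ³`.
`comoving_hjunc_frames` bridges the two with `frame_bridge_inner` (p585523): for weights `wa wb wc` that ARE the co-moving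
weights (hypotheses `hwa hwb hwc` by `rfl` in the assembly), `hjunc` holds.
-/

set_option linter.dupNamespace false

noncomputable section

namespace Summit.AnomalousDissipation.AnomalousDissipation.Theorems.SolenoidalFractalHomogenisation.RealisedQuasiStaticCellLaw

open Set MeasureTheory Filter Topology Function Complex Matrix
open scoped ComplexConjugate Matrix
open Literature.Analysis Literature.Analysis.FunctionSpaces Literature.Analysis.FunctionSpaces.Torus
open Literature.Analysis.FluidPDE Literature.Analysis.FluidPDE.LatticeShear

variable {k₀ : ℕ}

/-- **The junction hypothesis of `isoSector_decay_ae` for the co-moving weights.** -/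
theorem comoving_hjunc_frames (W : LatticeWord k₀) (ℓ : Fin 3 → ℤ) (hℓ : ℓ ≠ 0)
    (ζr : Fin k₀ → Fin 3 → ℝ) (hζ1 : ∀ j, ζr j ⬝ᵥ ζr j = 1) (hζ0 : ∀ j, ζr j ⬝ᵥ (fun i => ((ℓ i : ℤ) : ℝ)) = 0)
    (pf : Fin k₀ → ℤ → Fin 3 → ℝ) (hp0 : ∀ j, pf j 0 = ((Real.sqrt ((fun i => ((ℓ i : ℤ) : ℝ)) ⬝ᵥ (fun i => ((ℓ i : ℤ) : ℝ))))⁻¹ • (fun i => ((ℓ i : ℤ) : ℝ))) ⨯₃ ζr j)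
    (Λ d0 σo σi g₁ rc rs : Fin k₀ → ℝ) (lam : ℝ) (c₁₁ c₁₂ c₂₁ c₂₂ : ℕ → ℝ)
    (hrc : ∀ j, rc j = ζr ⟨0, W.pos⟩ ⬝ᵥ ζr j) (hrs : ∀ j, rs j = (((Real.sqrt ((fun i => ((ℓ i : ℤ) : ℝ)) ⬝ᵥ (fun i => ((ℓ i : ℤ) : ℝ))))⁻¹ • (fun i => ((ℓ i : ℤ) : ℝ))) ⨯₃ ζr ⟨0, W.pos⟩) ⬝ᵥ ζr j)
    (hCsucc : ∀ j : Fin k₀, c₁₁ ((j : ℕ) + 1) = c₁₁ j * (rc j ^ 2 * Real.exp (Λ j * (d0 j * (W.phase j).τ + σo j * g₁ j ^ 2 * ((W.phase j).τ * (1 - 4 * W.ramp / 3)))) + rs j ^ 2 * Real.exp (Λ j * (d0 j * (W.phase j).τ + σi j * g₁ j ^ 2 * ((W.phase j).τ * (1 - 4 * W.ramp / 3))))) + c₁₂ j * (rc j * rs j * (Real.exp (Λ j * (d0 j * (W.phase j).τ + σo j * g₁ j ^ 2 * ((W.phase j).τ * (1 - 4 * W.ramp / 3)))) - Real.exp (Λ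 j * (d0 j * (W.phase j).τ + σi j * g₁ j ^ 2 * ((W.phase j).τ * (1 - 4 * W.ramp / 3)))))) ∧
        c₁₂ ((j : ℕ) + 1) = c₁₁ j * (rc j * rs j * (Real.exp (Λ j * (d0 j * (W.phase j).τ + σo j * g₁ j ^ 2 * ((W.phase j).τ * (1 - 4 * W.ramp / 3)))) - Real.exp (Λ j * (d0 j * (W.phase j).τ + σi j * g₁ j ^ 2 * ((W.phase j).τ * (1 - 4 * W.ramp / 3)))))) + c₁₂ j * (rs j ^ 2 * Real.exp (Λ j * (d0 j * (W.phase j).τ + σo j * g₁ j ^ 2 * ((W.phase j).τ * (1 - 4 * W.ramp / 3)))) + rc j ^ 2 * Real.exp (Λ j * (d0 j * (W.phase j).τ + σi j * g₁ j ^ 2 * ((W.phase j).τ * (1 - 4 * W.ramp / 3))))) ∧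
        c₂₁ ((j : ℕ) + 1) = c₂₁ j * (rc j ^ 2 * Real.exp (Λ j * (d0 j * (W.phase j).τ + σo j * g₁ j ^ 2 * ((W.phase j).τ * (1 - 4 * W.ramp / 3)))) + rs j ^ 2 * Real.exp (Λ j * (d0 j * (W.phase j).τ + σi j * g₁ j ^ 2 * ((W.phase j).τ * (1 - 4 * W.ramp / 3))))) + c₂₂ j * (rc j * rs j * (Real.exp (Λ j * (d0 j * (W.phase j).τ + σo j * g₁ j ^ 2 * ((W.phase j).τ * (1 - 4 * W.ramp / 3)))) - Real.exp (Λ j * (d0 j * (W.phase j).τ + σi j * g₁ j ^ 2 * ((W.phase j).τ * (1 - 4 * W.ramp / 3)))))) ∧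
        c₂₂ ((j : ℕ) + 1) = c₂₁ j * (rc j * rs j * (Real.exp (Λ j * (d0 j * (W.phase j).τ + σo j * g₁ j ^ 2 * ((W.phase j).τ * (1 - 4 * W.ramp / 3)))) - Real.exp (Λ j * (d0 j * (W.phase j).τ + σi j * g₁ j ^ 2 * ((W.phase j).τ * (1 - 4 * W.ramp / 3)))))) + c₂₂ j * (rs j ^ 2 * Real.exp (Λ j * (d0 j * (W.phase j).τ + σo j * g₁ j ^ 2 * ((W.phase j).τ * (1 - 4 * W.ramp / 3)))) + rc j ^ 2 * Real.exp (Λ j * (d0 j * (W.phase j).τ + σi j * g₁ j ^ 2 * ((W.phase j).τ * (1 - 4 * W.ramp / 3))))))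
    (wa wb : ℕ → Fin k₀ → ℝ → ℝ) (wc : ℕ → Fin k₀ → ℝ → ℂ)
    (hwa : ∀ q : ℕ, ∀ j : Fin k₀, ∀ t : ℝ, wa q j t = Real.exp (-(2 * lam * (t - (q : ℝ) * W.period)) + 2 * (Λ j * (d0 j * (t - ((q : ℝ) * W.period + W.start j)) + σo j * g₁ j ^ 2 * (∫ s in (0:ℝ)..(t - ((q : ℝ) * W.period + W.start j)), LatticeWord.trapezoid 0 (W.phase j).τ W.ramp s ^ 2)))) * ((c₁₁ j * rc j + c₁₂ j * rs j) ^ 2 + (c₂₁ j * rc j + c₂₂ j * rs j) ^ 2))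
    (hwb : ∀ q : ℕ, ∀ j : Fin k₀, ∀ t : ℝ, wb q j t = Real.exp (-(2 * lam * (t - (q : ℝ) * W.period)) + 2 * (Λ j * (d0 j * (t - ((q : ℝ) * W.period + W.start j)) + σi j * g₁ j ^ 2 * (∫ s in (0:ℝ)..(t - ((q : ℝ) * W.period + W.start j)), LatticeWord.trapezoid 0 (W.phase j).τ W.ramp s ^ 2)))) * ((-(c₁₁ j * rs j) + c₁₂ j * rc j) ^ 2 + (-(c₂₁ j * rs j) + c₂₂ j * rc j) ^ 2))
    (hwc : ∀ q : ℕ, ∀ j : Fin k₀, ∀ t : ℝ, wc q j t = (((Real.exp (-(2 * lam * (t - (q : ℝ) * W.period)) + (Λ j * (d0 j * (t - ((q : ℝ) * W.period + W.start j)) + σo j * g₁ j ^ 2 * (∫ s in (0:ℝ)..(t - ((q : ℝ) * W.period + W.start j)), LatticeWord.trapezoid 0 (W.phase j).τ W.ramp s ^ 2))) + (Λ j * (d0 j * (t - ((q : ℝ) * W.period + W.start j)) + σi j * g₁ j ^ 2 * (∫ s in (0:ℝ)..(t - ((q : ℝ) * W.period + W.start j)), LatticeWord.trapezoid 0 (W.phase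 j).τ W.ramp s ^ 2)))) * ((c₁₁ j * rc j + c₁₂ j * rs j) * (-(c₁₁ j * rs j) + c₁₂ j * rc j) + (c₂₁ j * rc j + c₂₂ j * rs j) * (-(c₂₁ j * rs j) + c₂₂ j * rc j))) : ℝ) : ℂ)) :
    ∀ q : ℕ, ∀ j : Fin k₀, ∀ hj : j.val + 1 < k₀, ∀ u : EuclideanSpace ℂ (Fin 3),
      (fun i => ((ℓ i : ℤ) : ℂ)) ⬝ᵥ WithLp.ofLp u = 0 →
        wa q ⟨j.val + 1, hj⟩ ((q : ℝ) * W.period + W.start ⟨j.val + 1, hj⟩) * ‖inner ℂ (WithLp.toLp 2 (Complex.ofReal ∘ ζr ⟨j.val + 1, hj⟩) : EuclideanSpace ℂ (Fin 3)) u‖ ^ 2 +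
          wb q ⟨j.val + 1, hj⟩ ((q : ℝ) * W.period + W.start ⟨j.val + 1, hj⟩) * ‖inner ℂ (WithLp.toLp 2 (Complex.ofReal ∘ pf ⟨j.val + 1, hj⟩ 0) : EuclideanSpace ℂ (Fin 3)) u‖ ^ 2 +
          2 * (wc q ⟨j.val + 1, hj⟩ ((q : ℝ) * W.period + W.start ⟨j.val + 1, hj⟩) * conj (inner ℂ (WithLp.toLp 2 (Complex.ofReal ∘ ζr ⟨j.val + 1, hj⟩) : EuclideanSpace ℂ (Fin 3)) u) * inner ℂ (WithLp.toLp 2 (Complex.ofReal ∘ pf ⟨j.val + 1, hj⟩ 0) : EuclideanSpace ℂ (Fin 3)) u).re ≤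
        wa q j ((q : ℝ) * W.period + W.start j + (W.phase j).τ) * ‖inner ℂ (WithLp.toLp 2 (Complex.ofReal ∘ ζr j) : EuclideanSpace ℂ (Fin 3)) u‖ ^ 2 +
          wb q j ((q : ℝ) * W.period + W.start j + (W.phase j).τ) * ‖inner ℂ (WithLp.toLp 2 (Complex.ofReal ∘ pf j 0) : EuclideanSpace ℂ (Fin 3)) u‖ ^ 2 +
          2 * (wc q j ((q : ℝ) * W.period + W.start j + (W.phase j).τ) * conj (inner ℂ (WithLp.toLp 2 (Complex.ofReal ∘ ζr j) : EuclideanSpace ℂ (Fin 3)) u) * inner ℂ (WithLp.toLp 2 (Complex.ofReal ∘ pf j 0) : EuclideanSpace ℂ (Fin 3)) u).re := by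
  intro q j hj u _
  have h00 := hζ1 ⟨0, W.pos⟩
  have h0k := hζ0 ⟨0, W.pos⟩
  have hrot : ∀ j, rc j ^ 2 + rs j ^ 2 = 1 := fun j => by
    rw [hrc j, hrs j]; exact (frame_bridge_inner hℓ h00 h0k (hζ1 j) (hζ0 j) u).2.2
  obtain ⟨e1a, e1b, -⟩ := frame_bridge_inner hℓ h00 h0k (hζ1 ⟨(j : ℕ) + 1, hj⟩) (hζ0 ⟨(j : ℕ) + 1, hj⟩) u
  obtain ⟨e2a, e2b, -⟩ := frame_bridge_inner hℓ h00 h0k (hζ1 j) (hζ0 j) u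
  rw [hp0 ⟨(j : ℕ) + 1, hj⟩, hp0 j, e1a, e1b, e2a, e2b, ← hrc ⟨(j : ℕ) + 1, hj⟩, ← hrs ⟨(j : ℕ) + 1, hj⟩, ← hrc j, ← hrs j]
  simp only [hwa, hwb, hwc]
  exact comoving_junc W Λ d0 σo σi g₁ rc rs lam c₁₁ c₁₂ c₂₁ c₂₂ hrot hCsucc q j hj _ _

end Summit.AnomalousDissipation.AnomalousDissipation.Theorems.SolenoidalFractalHomogenisation.RealisedQuasiStaticCellLaw

end
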